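import Mathlib.Computability.PartrecCode
import Mathlib.Computability.Encoding
import Mathlib.Data.ENat.Lattice
import Mathlib.Data.Set.Card
import Mathlib.Data.Fintype.BigOperators
import Literature.Computability.Complexity.BoolEncodings
import HarnessLib

-- provenance: harness21/H21/H21/Prelude/CplxMeta/Kolmogorov.lean @ c423f1e (interim HEAD d8f2665); M5 mechanical rewrite
/-!
# Meta-complexity prelude: plain Kolmogorov complexity

Trunk `CplxMeta`, concept C1 (`Kolmogorov`), realising the notion `kolmogorov_K_plain`.

A *description method* is a partial function `φ : List Bool →. List Bool` on binary strings
(Li–Vitányi's "specification method"). The complexity of `x` with respect to `φ` is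
`C_φ(x) = min {|p| : φ(p) = x}`, valued in `ℕ∞` (`⊤` when `x` has no `φ`-description). A
partial recursive `φ₀` is *additively optimal* (universal) if `C_{φ₀}(x) ≤ C_φ(x) + c_φ` for every
partial recursive `φ`. We fix a REAL reference method `univDescription`: a program is a
`boolPair` of (the binary encoding of the Gödel number of) a `Nat.Partrec.Code` and an input
string; the code is run on the `Encodable` code of the input and the output is decoded back to a
string. Plain Kolmogorov complexity `C(x) := C_{univDescription}(x)`, an honest natural number
because every string has a description (`descComplexity_univDescription_lt_top`, real proof).

Mathlib has no Kolmogorov complexity (grep: no `Kolmogorov` outside probability); we reuse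
`PFun`/`Part`, `Partrec`, `Nat.Partrec.Code`, `Nat.Partrec.Code.eval`, `Nat.Partrec.Code.const`,
`Nat.Partrec.Code.eval_const`, `Denumerable.ofNat`, `Computability.decodeNat`/`encodeNat`,
`Set.ncard`, `ENat.toNat`, and G01's `Literature.Computability.Complexity.boolPair`/`boolUnpair`.

## Design notes

* Min-size measures are `ℕ∞`-valued `⨅` (trunk rule); `kolmogorovComplexity` projects with
  `ENat.toNat`, whose junk value `⊤.toNat = 0` is provably never taken.
* The invariance theorem (LV Thm 2.1.1) and additive optimality of `univDescription` are
  `sorry`d known theorems; the two-sided invariance theorem and uncomputability of `C` carry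
  statement ids in the `CryptoFoundations` statements file.
* Conditional complexity `C(x | y)` is the cheap specialisation
  `condDescComplexity φ x y := C_{p ↦ φ ⟨y, p⟩}(x)`.

## References

* M. Li, P. Vitányi, *An Introduction to Kolmogorov Complexity and Its Applications*, 3rd ed.,
  Springer 2008, §2.0 (Def 2.0.1), §2.1 (Def 2.1.1, Thm 2.1.1 invariance, Thm 2.1.2),
  §2.2 (counting, Thm 2.2.1), §2.3 (`C` is not computable, Thm 2.3.2).
-/

namespace Literature.Computability.MetaComplexity

open _root_.Computability Complexity

/-! ### Complexity with respect to a description method -/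

/-- The description complexity `C_φ(x)` of a string `x` with respect to a description method
`φ : {0,1}* →. {0,1}*`: the least length of a `p` with `φ p = x`, as an element of `ℕ∞`
(`⊤` iff `x` has no `φ`-description). [Li–Vitányi 2008, Def 2.0.1] [cite: LiVitanyi2008, Def 2.0.1] -/
noncomputable def descComplexity (φ : List Bool →. List Bool) (x : List Bool) : ℕ∞ :=
  ⨅ (p : List Bool) (_ : x ∈ φ p), (p.length : ℕ∞)

/-- A description method `φ₀` is *additively optimal* (universal) for the class of partial
recursive description methods: it is itself partial recursive and for every partial recursive
`φ` there is a constant `c_φ` with `C_{φ₀}(x) ≤ C_φ(x) + c_φ` for all `x`.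
[Li–Vitányi 2008, Def 2.0.1] [cite: LiVitanyi2008, Def 2.0.1] -/
def IsAdditivelyOptimal (φ₀ : List Bool →. List Bool) : Prop :=
  Partrec φ₀ ∧ ∀ φ : List Bool →. List Bool, Partrec φ →
    ∃ c : ℕ, ∀ x : List Bool, descComplexity φ₀ x ≤ descComplexity φ x + c

/-- The reference universal description method. A program `p` is split as
`p = boolPair e w`; `e` is read as the binary encoding (`decodeNat`) of the Gödel number of a
`Nat.Partrec.Code`, which is evaluated on `Encodable.encode w`; the resulting natural number is
decoded back to a string (`Encodable.decode`, failure = divergence). Malformed programs fall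
under `boolUnpair`'s junk value `([], [])`, i.e. run code `0` on `[]`, which is harmless.
[Li–Vitányi 2008, §2.1, proof of Thm 2.1.1 (the reference machine `⟨n, p⟩ ↦ φₙ(p)`)] [cite: LiVitanyi2008, §2.1  proof of Thm 2.1.1 (the reference] -/
def univDescription : List Bool →. List Bool := fun p =>
  ((Denumerable.ofNat Nat.Partrec.Code (decodeNat (boolUnpair p).1)).eval
      (Encodable.encode (boolUnpair p).2)).bind
    fun n => (Encodable.decode (α := List Bool) n : Part (List Bool))

/-- Plain Kolmogorov complexity `C(x) := C_{univDescription}(x)` as a natural number. The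
projection `ENat.toNat` (junk `⊤ ↦ 0`) never takes its junk value, by
`descComplexity_univDescription_lt_top`; the uncomputability statement
`¬ Computable kolmogorovComplexity` (crypto S11, LV Thm 2.3.2) relies on this.
[Li–Vitányi 2008, Def 2.1.2] [cite: LiVitanyi2008, Def 2.1.2] -/
noncomputable def kolmogorovComplexity (x : List Bool) : ℕ :=
  (descComplexity univDescription x).toNat

/-- Conditional description complexity `C_φ(x | y)`: the complexity of `x` with respect to the
method `p ↦ φ ⟨y, p⟩` that has `y` hard-wired via `boolPair`. [Li–Vitányi 2008, Def 2.1.2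
(conditional complexity)] [cite: LiVitanyi2008, Def 2.1.2 (conditional complexity] -/
noncomputable def condDescComplexity (φ : List Bool →. List Bool) (x y : List Bool) : ℕ∞ :=
  descComplexity (fun p => φ (boolPair y p)) x

/-! ### Basic API -/

section API

variable {φ : List Bool →. List Bool} {x p : List Bool}

/-- Any description bounds the complexity: `φ p = x → C_φ(x) ≤ |p|`.
[Li–Vitányi 2008, Def 2.0.1] [cite: LiVitanyi2008, Def 2.0.1] -/
theorem descComplexity_le_length (h : x ∈ φ p) : descComplexity φ x ≤ p.length :=
  iInf₂_le p h

/-- `C_φ(x) = ⊤` iff `x` has no `φ`-description. [Li–Vitányi 2008, Def 2.0.1] [cite: LiVitanyi2008, Def 2.0.1] -/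
theorem descComplexity_eq_top_iff : descComplexity φ x = ⊤ ↔ ∀ p, x ∉ φ p := by
  simp [descComplexity, iInf_eq_top]

/-- `C_φ(x) < ⊤` iff `x` has some `φ`-description. [Li–Vitányi 2008, Def 2.0.1] [cite: LiVitanyi2008, Def 2.0.1] -/
theorem descComplexity_lt_top_iff : descComplexity φ x < ⊤ ↔ ∃ p, x ∈ φ p := by
  rw [lt_top_iff_ne_top, Ne, descComplexity_eq_top_iff]
  push Not
  rfl

/-- If `C_φ(x) < m` (with `m : ℕ`) then some description of `x` has length `< m`.
[Li–Vitányi 2008, §2.2] [cite: LiVitanyi2008, §2.2] -/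
theorem exists_length_lt_of_descComplexity_lt {m : ℕ} (h : descComplexity φ x < m) :
    ∃ p, x ∈ φ p ∧ p.length < m := by
  by_contra hcon
  push Not at hcon
  refine (lt_irrefl (m : ℕ∞)) (lt_of_le_of_lt ?_ h)
  refine le_iInf₂ fun p hp => ?_
  exact_mod_cast hcon p hp

/-- Counting: fewer than `2 ^ m` strings have `φ`-complexity `< m`, since there are only
`2 ^ m - 1` programs of length `< m` and each describes at most one string.
[Li–Vitányi 2008, Thm 2.2.1] [cite: LiVitanyi2008, Thm 2.2.1] -/
theorem ncard_setOf_descComplexity_lt (φ : List Bool →. List Bool) (m : ℕ) :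
    {x | descComplexity φ x < m}.ncard < 2 ^ m := by
  classical
  -- the finite set of programs of length `< m`
  set T : Finset (List Bool) := (Finset.range m).biUnion
    fun k => (Finset.univ : Finset (List.Vector Bool k)).image List.Vector.toList with hT
  have hTcard : T.card < 2 ^ m := by
    calc T.card ≤ ∑ k ∈ Finset.range m,
          ((Finset.univ : Finset (List.Vector Bool k)).image List.Vector.toList).card :=
          Finset.card_biUnion_le
      _ ≤ ∑ k ∈ Finset.range m, 2 ^ k := Finset.sum_le_sum fun k _ =>
          Finset.card_image_le.trans (by rw [Finset.card_univ, card_vector, Fintype.card_bool])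
      _ < 2 ^ m := by
          clear hT T
          induction m with
          | zero => simp
          | succ n ih => rw [Finset.sum_range_succ, pow_succ]; omega
  have hmem : ∀ x ∈ {x | descComplexity φ x < m}, ∃ p, x ∈ φ p ∧ p.length < m :=
    fun x hx => exists_length_lt_of_descComplexity_lt hx
  choose! f hf using hmem
  have hinj : Set.InjOn f {x | descComplexity φ x < m} := fun x hx y hy hxy =>
    Part.mem_unique (hf x hx).1 (hxy ▸ (hf y hy).1)
  have hmaps : ∀ x ∈ {x | descComplexity φ x < m}, f x ∈ (T : Set (List Bool)) := by
    intro x hx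
    obtain ⟨-, hx2⟩ := hf x hx
    simp only [hT, Finset.coe_biUnion, Finset.coe_range, Set.mem_iUnion, Finset.coe_image,
      Set.mem_image, Set.mem_Iio]
    exact ⟨(f x).length, hx2, (⟨f x, rfl⟩ : List.Vector Bool (f x).length),
      Finset.mem_coe.2 (Finset.mem_univ _), rfl⟩
  calc {x | descComplexity φ x < m}.ncard
      ≤ (T : Set (List Bool)).ncard :=
        Set.ncard_le_ncard_of_injOn f hmaps hinj (Finset.finite_toSet T)
    _ = T.card := Set.ncard_coe_finset T
    _ < 2 ^ m := hTcard

end API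

/-! ### The reference method -/

/-- The reference description method is partial recursive (composition of `boolUnpair`,
`decodeNat`, `Code.eval` and `decode`, all computable/partial recursive).
[Li–Vitányi 2008, §2.1; Mathlib `Nat.Partrec.Code.eval_part`] [cite: LiVitanyi2008, §2.1] -/
def partrec_univDescription : Prop :=
  Partrec univDescription

/-- The program `⟨encodeNat ⌜const (encode x)⌝, []⟩` describes `x` under `univDescription`.
[Li–Vitányi 2008, §2.1 (every string has a description); Mathlib
`Nat.Partrec.Code.eval_const`] [cite: LiVitanyi2008, §2.1 (every string has a description] -/
theorem mem_univDescription_boolPair_const (x : List Bool) :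
    x ∈ univDescription
      (boolPair (encodeNat (Encodable.encode (Nat.Partrec.Code.const (Encodable.encode x))))
        []) := by
  simp [univDescription, boolUnpair_boolPair, decode_encodeNat, Denumerable.ofNat_encode,
    Nat.Partrec.Code.eval_const, Encodable.encodek]

/-- Every string has a `univDescription`-description, so `C(x) < ⊤`: this certifies that the
`ENat.toNat` in `kolmogorovComplexity` never takes its junk value `⊤ ↦ 0` (needed by crypto
S11, `¬ Computable kolmogorovComplexity`). Real proof via `Nat.Partrec.Code.const`.
[Li–Vitányi 2008, §2.1, Thm 2.1.2 (`C(x) ≤ |x| + O(1)`, weak form)] [cite: LiVitanyi2008, §2.1  Thm 2.1.2 ( C(x] -/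
theorem descComplexity_univDescription_lt_top (x : List Bool) :
    descComplexity univDescription x < ⊤ :=
  descComplexity_lt_top_iff.2 ⟨_, mem_univDescription_boolPair_const x⟩

/-- `kolmogorovComplexity x`, cast back to `ℕ∞`, is the honest infimum
`descComplexity univDescription x` (no junk). [Li–Vitányi 2008, Def 2.1.2] [cite: LiVitanyi2008, Def 2.1.2] -/
theorem coe_kolmogorovComplexity (x : List Bool) :
    (kolmogorovComplexity x : ℕ∞) = descComplexity univDescription x :=
  ENat.coe_toNat (descComplexity_univDescription_lt_top x).ne

/-- **Invariance theorem** (existence half): the reference method `univDescription` is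
additively optimal, `C(x) ≤ C_φ(x) + c_φ` for every partial recursive `φ`.
[Li–Vitányi 2008, Thm 2.1.1] [cite: LiVitanyi2008, Thm 2.1.1] -/
def isAdditivelyOptimal_univDescription : Prop :=
  IsAdditivelyOptimal univDescription

/-- Upper bound: `C(x) ≤ |x| + O(1)` (take `φ = ` the identity method in the invariance
theorem). [Li–Vitányi 2008, Thm 2.1.2] [cite: LiVitanyi2008, Thm 2.1.2] -/
def kolmogorovComplexity_le_length_add : Prop :=
  ∃ c : ℕ, ∀ x : List Bool, kolmogorovComplexity x ≤ x.length + c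

end Literature.Computability.MetaComplexity
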